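import Literature.Geometry.Riemannian.MeanConvexSurroundingProofs

/-!
# Mean convexity from the trace of the Hessian: the `m`-subharmonic criterion

Topic `Geometry/Riemannian` (fact seat
`provefact-Literature.Geometry.Riemannian.LawsonMichelsohn1984_surrounding`).  Everything here
is **proved**.

The mean-convexity clause of `LawsonMichelsohn1984_surrounding` asks, at a point `x` of the
hypersurface `{F' = 0}`, that `∑ᵢ D²F'(x)(vᵢ, vᵢ) > 0` for the orthonormal `m`-frames `v` of the
tangent hyperplane `ker dF'(x)` of `ℝ^{m+1}`.  For *any* orthonormal `m`-frame `v` of an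
`(m + 1)`-dimensional inner product space and any bilinear form `B`,
`∑ᵢ B(vᵢ, vᵢ) = tr B - B(ν, ν)` for a unit vector `ν ⟂ v` (`sum_apply_orthonormal_eq_trace_sub`),
so the clause holds — for every hyperplane, whatever the gradient — as soon as
**`tr D²F'(x) > sup_{‖u‖ = 1} D²F'(x)(u, u)`**, i.e. as soon as the sum of the `m` smallest
eigenvalues of the Hessian is positive ("`F'` strictly `m`-subharmonic at `x`";
`sum_apply_orthonormal_pos_of_trace`, `sum_iteratedFDeriv_two_pos_of_trace`).  This is the form
in which mean convexity of tubes (`D²(dist²) ≈ 2 ·` normal projection, of trace `2 · codim ≥ 4`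
against `sup = 2`) and of the domains built from them is verified in the surrounding construction
(Lawson–Michelsohn 1984, §3: hypersurfaces around submanifolds of codimension `≥ 2` have `H > 0`).

## References

* H. B. Lawson, Jr., M.-L. Michelsohn, *Embedding and surrounding with positive mean curvature*,
  Invent. Math. 77 (1984), §§2–3. [LawsonMichelsohn1984]
* R. A. Horn, C. R. Johnson, *Matrix Analysis* (1985), Thm. 4.3.8 (Cauchy interlacing) — the
  eigenvalue form of `sum_apply_orthonormal_eq_trace_sub`. [folklore]
-/

noncomputable section

open Set Function Module
open scoped RealInnerProductSpace

namespace Literature.Geometry.Riemannian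

section LinearAlgebra

variable {E : Type*} [NormedAddCommGroup E] [InnerProductSpace ℝ E] [FiniteDimensional ℝ E]
  {m : ℕ}

/-- In an `(m + 1)`-dimensional inner product space every orthonormal `m`-frame has a unit
normal. [folklore] -/
theorem exists_norm_eq_one_forall_inner_eq_zero (hE : finrank ℝ E = m + 1) {v : Fin m → E}
    (hv : Orthonormal ℝ v) : ∃ ν : E, ‖ν‖ = 1 ∧ ∀ i, ⟪v i, ν⟫ = 0 := by
  have hspan : finrank ℝ (Submodule.span ℝ (Set.range v)) = m := by
    rw [finrank_span_eq_card hv.linearIndependent, Fintype.card_fin]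
  have hKd : finrank ℝ (Submodule.span ℝ (Set.range v))ᗮ = 1 := by
    have h1 := Submodule.finrank_add_finrank_orthogonal (Submodule.span ℝ (Set.range v))
    rw [hspan, hE] at h1
    omega
  have hKne : (Submodule.span ℝ (Set.range v))ᗮ ≠ ⊥ := fun h => by
    rw [h, finrank_bot] at hKd
    exact zero_ne_one hKd
  obtain ⟨w, hwK, hw0⟩ := Submodule.exists_mem_ne_zero_of_ne_bot hKne
  have hwn : ‖w‖ ≠ 0 := norm_ne_zero_iff.2 hw0
  refine ⟨‖w‖⁻¹ • w, ?_, fun i => ?_⟩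
  · rw [norm_smul, norm_inv, norm_norm, inv_mul_cancel₀ hwn]
  · rw [inner_smul_right, Submodule.inner_right_of_mem_orthogonal
      (Submodule.subset_span (mem_range_self i)) hwK, mul_zero]

/-- **`∑ᵢ B(vᵢ, vᵢ) = tr B - B(ν, ν)`**: for a bilinear form `B` on an `(m + 1)`-dimensional inner
product space and an orthonormal `m`-frame `v` there is a unit vector `ν ⟂ v` with
`∑ᵢ B(vᵢ, vᵢ) = ∑ⱼ B(bⱼ, bⱼ) - B(ν, ν)` for every orthonormal basis `b` (complete `v` by `ν` to an
orthonormal basis and use frame independence of the trace). [folklore] -/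
theorem sum_apply_orthonormal_eq_trace_sub (hE : finrank ℝ E = m + 1) (B : E →ₗ[ℝ] E →ₗ[ℝ] ℝ)
    {ι : Type*} [Fintype ι] (b : OrthonormalBasis ι ℝ E) {v : Fin m → E} (hv : Orthonormal ℝ v) :
    ∃ ν : E, ‖ν‖ = 1 ∧ (∀ i, ⟪v i, ν⟫ = 0) ∧
      ∑ i, B (v i) (v i) = ∑ j, B (b j) (b j) - B ν ν := by
  classical
  obtain ⟨ν, hν, hvν⟩ := exists_norm_eq_one_forall_inner_eq_zero hE hv
  refine ⟨ν, hν, hvν, ?_⟩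
  -- the completed frame
  set w : Fin m ⊕ Unit → E := Sum.elim v fun _ => ν with hw
  have hvo := orthonormal_iff_ite.1 hv
  have hwo : Orthonormal ℝ w := by
    rw [orthonormal_iff_ite]
    rintro (i | _) (j | _)
    · simpa [hw] using hvo i j
    · simp [hw, hvν i]
    · have : ⟪ν, v j⟫ = 0 := by rw [real_inner_comm]; exact hvν j
      simp [hw, this]
    · simp [hw, hν]
  have hcard : Fintype.card (Fin m ⊕ Unit) = finrank ℝ E := by simp [hE]
  have hsp : ⊤ ≤ Submodule.span ℝ (Set.range w) :=
    (hwo.linearIndependent.span_eq_top_of_card_eq_finrank' hcard).ge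
  have key := sum_apply_orthonormalBasis_eq B (OrthonormalBasis.mk hwo hsp) b
  rw [← key]
  simp [hw, Fintype.sum_sum_type]

/-- **The `m`-subharmonic criterion.**  If `B(u, u) ≤ Λ` for all unit vectors `u` and
`tr B > Λ` (in any orthonormal basis), then `∑ᵢ B(vᵢ, vᵢ) > 0` for every orthonormal `m`-frame `v`
of the `(m + 1)`-dimensional space: the sum of the `m` smallest eigenvalues of a symmetric form
bounds its trace on every hyperplane from below (Cauchy interlacing). [folklore] -/
theorem sum_apply_orthonormal_pos_of_trace (hE : finrank ℝ E = m + 1) (B : E →ₗ[ℝ] E →ₗ[ℝ] ℝ)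
    {ι : Type*} [Fintype ι] (b : OrthonormalBasis ι ℝ E) {Λ : ℝ} (hΛ : ∀ u : E, ‖u‖ = 1 → B u u ≤ Λ)
    (htr : Λ < ∑ j, B (b j) (b j)) {v : Fin m → E} (hv : Orthonormal ℝ v) :
    0 < ∑ i, B (v i) (v i) := by
  obtain ⟨ν, hν, -, hsum⟩ := sum_apply_orthonormal_eq_trace_sub hE B b hv
  rw [hsum]
  linarith [hΛ ν hν]

end LinearAlgebra

section Hessian

variable {E : Type*} [NormedAddCommGroup E] [InnerProductSpace ℝ E] [FiniteDimensional ℝ E]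
  {m : ℕ}

/-- **Strictly `m`-subharmonic functions have mean-convex levels, for every frame.**  If
`D²f(x)(u, u) ≤ Λ` for all unit `u` and the Laplacian `∑ⱼ D²f(x)(bⱼ, bⱼ)` (any orthonormal basis
`b` of the `(m + 1)`-dimensional space) exceeds `Λ`, then `∑ᵢ D²f(x)(vᵢ, vᵢ) > 0` for every
orthonormal `m`-frame `v` — in particular for the tangent frames of the level of `f` through `x`,
which is the mean-convexity clause of `LawsonMichelsohn1984_surrounding` at `x`
(Lawson–Michelsohn 1984, §2, (2.4)–(2.6)). [cite: LawsonMichelsohn1984, §2] -/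
theorem sum_iteratedFDeriv_two_pos_of_trace (hE : finrank ℝ E = m + 1) {f : E → ℝ} {x : E}
    {ι : Type*} [Fintype ι] (b : OrthonormalBasis ι ℝ E) {Λ : ℝ}
    (hΛ : ∀ u : E, ‖u‖ = 1 → iteratedFDeriv ℝ 2 f x ![u, u] ≤ Λ)
    (htr : Λ < ∑ j, iteratedFDeriv ℝ 2 f x ![b j, b j]) (v : Fin m → E) (hv : Orthonormal ℝ v) :
    0 < ∑ i, iteratedFDeriv ℝ 2 f x ![v i, v i] := by
  -- the Hessian as a bilinear form
  set B : E →ₗ[ℝ] E →ₗ[ℝ] ℝ :=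
    (ContinuousLinearMap.coeLM ℝ).comp (fderiv ℝ (fderiv ℝ f) x).toLinearMap with hB
  have hBapp : ∀ a c, B a c = iteratedFDeriv ℝ 2 f x ![a, c] := fun a c => by
    rw [iteratedFDeriv_two_vecCons]; rfl
  have h := sum_apply_orthonormal_pos_of_trace hE B b (Λ := Λ)
    (fun u hu => by rw [hBapp]; exact hΛ u hu) (by simpa only [hBapp] using htr) hv
  simpa only [hBapp] using h

/-- `sum_iteratedFDeriv_two_pos_of_trace` in the setting of the fact, `ℝ^{m+1}` as
`EuclideanSpace ℝ (Fin (m + 1))`. [cite: LawsonMichelsohn1984, §2] -/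
theorem sum_iteratedFDeriv_two_pos_of_trace_euclidean {f : EuclideanSpace ℝ (Fin (m + 1)) → ℝ}
    {x : EuclideanSpace ℝ (Fin (m + 1))} {ι : Type*} [Fintype ι]
    (b : OrthonormalBasis ι ℝ (EuclideanSpace ℝ (Fin (m + 1)))) {Λ : ℝ}
    (hΛ : ∀ u, ‖u‖ = 1 → iteratedFDeriv ℝ 2 f x ![u, u] ≤ Λ)
    (htr : Λ < ∑ j, iteratedFDeriv ℝ 2 f x ![b j, b j]) (v : Fin m → EuclideanSpace ℝ (Fin (m + 1)))
    (hv : Orthonormal ℝ v) : 0 < ∑ i, iteratedFDeriv ℝ 2 f x ![v i, v i] :=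
  sum_iteratedFDeriv_two_pos_of_trace finrank_euclideanSpace_fin b hΛ htr v hv

end Hessian

end Literature.Geometry.Riemannian

end
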